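import Literature.Analysis.FluidPDE.SmoothL2FieldCalculus
import Literature.Analysis.FluidPDE.CheskidovShvydkoyBlockTime
import Literature.Analysis.FunctionSpaces.LittlewoodPaleyProducts
import Literature.Analysis.FunctionSpaces.ParaproductSums
import HarnessLib

/-!
# The nonlinear term of the block energy balance: divergence form and paraproduct bound

Analysis/FluidPDE support file (serves the discharge of
`Literature.Analysis.FluidPDE.cheskidov_shvydkoy`, ns.S31). In the proof of Lemma 3.2 of
Cheskidov–Shvydkoy (arXiv:0708.3067, p. 5) the flux term `∫ Tr[(u ⊗ u)_q · ∇u_q]` of the block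
energy balance (8) is decomposed by Bony's paraproduct formula into `I + II + III` and bounded using the
smallness (6) of the high blocks in `B^{-1}_{∞,∞}` and Bernstein's inequalities. This file **proves**
the corresponding statement for the `H¹`-weighted form used in the tree, for a divergence-free smooth
`L²` field `v` on `ℝ^ι` (all `[folklore]` unless cited):

* `convect_eq_sum_fderiv_flux`, `integral_inner_blockFn_convect_eq`: the divergence form
  `(v·∇)v = ∑_i ∂_i(⟪v,b_i⟫ v)` and, after an integration by parts,
  `∫ ⟪v_j, Δ̇_j((v·∇)v)⟫ = -∑_i 𝒯_j(∂_i v_j; v, v)` with the trilinear pieces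
  `𝒯_j(g; f, w) = ∫ ⟪g, Δ̇_j(⟪f, b_i⟫ w)⟫` (`trilin`);
* `trilin_blockFn_blockFn_eq_zero`: `𝒯_j(g; Δ̇_l v, Δ̇_{l'} v) = 0` for the vanishing configurations of
  `LittlewoodPaleyProducts.lean` (Fourier supports);
* bilinearity and `L²`-continuity of `𝒯_j` in each slot, hence (`enorm_trilin_le_tsum_tsum`)
  `‖𝒯_j(g; v, v)‖ ≤ ∑_l ∑_{l'} ‖𝒯_j(g; Δ̇_l v, Δ̇_{l'} v)‖` when the partial block sums converge to `v`
  in `L²` (`LittlewoodPaleyFields.lean` supplies this for `L²` fields);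
* `enorm_trilin_blockFn_blockFn_le`, `tsum_tsum_enorm_trilin_le`: each surviving pair is low–high,
  high–low or diagonal and is bounded through Hölder by `‖g‖₂ C₂ ‖Δ̇_l v‖_∞ ‖Δ̇_{l'} v‖₂` (or the
  symmetric product); summing gives the shapes `paraT`, `paraQ2` of `ParaproductSums.lean`;
* `enorm_integral_inner_blockFn_convect_le`: the bound on the nonlinear term of the `j`-th block
  balance, `‖∫ ⟪v_j, Δ̇_j((v·∇)v)⟫‖ ≤ (∑_i ‖∂_i v_j‖₂) C₂ (2 ∑_{|m|≤2} a_{j+m} T_{j+m} + Q₂(j))`.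

## References

* A. Cheskidov, R. Shvydkoy, Arch. Ration. Mech. Anal. 195 (2010) 159–169 = arXiv:0708.3067,
  proof of Lemma 3.2, p. 5. [CheskidovShvydkoy2010]
* H. Bahouri, J.-Y. Chemin, R. Danchin, Fourier Analysis and Nonlinear PDE, Springer 2011, §2.6–2.8
  (paraproducts). [BahouriCheminDanchin2011]
-/

noncomputable section

open MeasureTheory Filter Topology Function Set
open Literature.Analysis.FunctionSpaces
open scoped ENNReal NNReal RealInnerProductSpace

namespace Literature.Analysis.FluidPDE

variable {E : Type*} [NormedAddCommGroup E] [InnerProductSpace ℝ E] [FiniteDimensional ℝ E]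
  [MeasurableSpace E] [BorelSpace E]

/-! ## The nonlinear term in divergence form and its integration by parts -/

section DivergenceForm

/-- The momentum flux pieces `Π_i = ⟪v, b_i⟫ v` of a smooth `L²` field are smooth `L²` fields. [folklore] -/
theorem _root_.Literature.Analysis.FunctionSpaces.IsSmoothL2Field.flux {v : E → E} (hv : IsSmoothL2Field v) (e : E) :
    IsSmoothL2Field (fun x => ⟪v x, e⟫ • v x) :=
  hv.smul_left (hv.toHasBoundedDerivs.inner_const e)

omit [MeasurableSpace E] [BorelSpace E] in
/-- **The convective term in divergence form**: for a divergence-free `C¹` field,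
`(v·∇)v = ∑_i ∂_i (⟪v, b_i⟫ v)` along an orthonormal basis (`∑_i ∂_i⟪v,b_i⟫ = div v = 0`). [folklore] -/
theorem convect_eq_sum_fderiv_flux {v : E → E} (hv : ContDiff ℝ 1 v) (hdiv : VectorCalculus.IsDivFree v) (x : E) :
    convect v v x = ∑ i, fderiv ℝ (fun y => ⟪v y, stdOrthonormalBasis ℝ E i⟫ • v y) x (stdOrthonormalBasis ℝ E i) := by
  set b := stdOrthonormalBasis ℝ E
  have hd : ∀ y, HasFDerivAt v (fderiv ℝ v y) y := fun y => (hv.differentiable one_ne_zero y).hasFDerivAt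
  have hprod : ∀ i, fderiv ℝ (fun y => ⟪v y, b i⟫ • v y) x (b i) =
      ⟪fderiv ℝ v x (b i), b i⟫ • v x + ⟪v x, b i⟫ • fderiv ℝ v x (b i) := by
    intro i
    have h1 : HasFDerivAt (fun y => ⟪v y, b i⟫) ((innerSL ℝ (b i)).comp (fderiv ℝ v x)) x :=
      hasFDerivAt_inner_const_field hv (b i) x
    have h2 := h1.smul (hd x)
    have h3 : fderiv ℝ (fun y => ⟪v y, b i⟫ • v y) x = ⟪v x, b i⟫ • fderiv ℝ v x +
        ((innerSL ℝ (b i)).comp (fderiv ℝ v x)).smulRight (v x) := h2.fderiv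
    rw [h3]
    simp only [add_apply, smul_apply, ContinuousLinearMap.smulRight_apply,
      ContinuousLinearMap.coe_comp, Function.comp_apply, innerSL_apply_apply, real_inner_comm (b i)]
    rw [add_comm]
  simp_rw [hprod, Finset.sum_add_distrib]
  have hdiv' : ∑ i, ⟪fderiv ℝ v x (b i), b i⟫ • v x = 0 := by
    rw [← Finset.sum_smul]
    have : ∑ i, ⟪fderiv ℝ v x (b i), b i⟫ = VectorCalculus.divergence v x := by
      rw [divergence_eq_sum_inner_fderiv b]
      exact Finset.sum_congr rfl fun i _ => real_inner_comm _ _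
    rw [this, hdiv x, zero_smul]
  rw [hdiv', zero_add, convect_apply]
  conv_lhs => rw [← b.sum_repr' (v x)]
  simp only [map_sum, map_smul, real_inner_comm (v x)]

/-- **The nonlinear term of the block energy balance after integration by parts**
(Cheskidov–Shvydkoy's `∫ Tr[(u ⊗ u)_q · ∇u_q]`, arXiv:0708.3067 p. 5): for a divergence-free smooth
`L²` field `v` with `v_j = Δ̇_j v`,
`∫ ⟪v_j, Δ̇_j ((v·∇)v)⟫ = -∑_i ∫ ⟪∂_i v_j, Δ̇_j (⟪v, b_i⟫ v)⟫`. [folklore] -/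
theorem integral_inner_blockFn_convect_eq {v : E → E} (hv : IsSmoothL2Field v)
    (hdiv : VectorCalculus.IsDivFree v) (j : ℤ) :
    ∫ x, ⟪blockFn j v x, blockFn j (convect v v) x⟫ =
      -∑ i, ∫ x, ⟪fderiv ℝ (blockFn j v) x (stdOrthonormalBasis ℝ E i),
        blockFn j (fun y => ⟪v y, stdOrthonormalBasis ℝ E i⟫ • v y) x⟫ := by
  haveI : Fact (1 ≤ (2 : ℝ≥0∞)) := ⟨one_le_two⟩
  set b := stdOrthonormalBasis ℝ E
  set w := blockFn j v with hw
  have hwS : IsSmoothL2Field w := hv.blockFn j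
  have hPi : ∀ i, IsSmoothL2Field (fun x => ⟪v x, b i⟫ • v x) := fun i => hv.flux (b i)
  -- the convective term in divergence form, then through the block
  have hconv : convect v v = ∑ i, fun x => fderiv ℝ (fun y => ⟪v y, b i⟫ • v y) x (b i) := by
    funext x; rw [convect_eq_sum_fderiv_flux (hv.contDiff_nat 1) hdiv x, Finset.sum_apply]
  have hblock : blockFn j (convect v v) =
      ∑ i, fun x => fderiv ℝ (blockFn j (fun y => ⟪v y, b i⟫ • v y)) x (b i) := by
    rw [hconv, blockFn_sum j _ fun i _ => ((hPi i).fderiv_apply (b i)).memLp_two]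
    refine Finset.sum_congr rfl fun i _ => ?_
    exact ((hPi i).toHasBoundedDerivs.fderiv_blockFn_apply j (b i)).symm
  rw [hblock]
  have hint : ∀ i, Integrable (fun x => ⟪w x, fderiv ℝ (blockFn j (fun y => ⟪v y, b i⟫ • v y)) x (b i)⟫) volume :=
    fun i => integrable_inner_of_memLp_two hwS.memLp_two (((hPi i).blockFn j).memLp_fderiv_apply (b i))
  have hsum : ∀ x, ⟪w x, (∑ i, fun x => fderiv ℝ (blockFn j (fun y => ⟪v y, b i⟫ • v y)) x (b i)) x⟫ =
      ∑ i, ⟪w x, fderiv ℝ (blockFn j (fun y => ⟪v y, b i⟫ • v y)) x (b i)⟫ := by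
    intro x; rw [Finset.sum_apply, inner_sum]
  simp_rw [hsum]
  rw [integral_finsetSum _ fun i _ => hint i, ← Finset.sum_neg_distrib]
  refine Finset.sum_congr rfl fun i _ => ?_
  -- integration by parts in the direction `b i`
  set g := blockFn j (fun y => ⟪v y, b i⟫ • v y) with hg
  have hgS : IsSmoothL2Field g := (hPi i).blockFn j
  have i1 : Integrable (fun x => ⟪fderiv ℝ w x (b i), g x⟫) volume :=
    integrable_inner_of_memLp_two (hwS.memLp_fderiv_apply (b i)) hgS.memLp_two
  have i2 : Integrable (fun x => ⟪w x, fderiv ℝ g x (b i)⟫) volume :=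
    integrable_inner_of_memLp_two hwS.memLp_two (hgS.memLp_fderiv_apply (b i))
  have i3 : Integrable (fun x => ⟪w x, g x⟫) volume := integrable_inner_of_memLp_two hwS.memLp_two hgS.memLp_two
  have key := integral_bilinear_hasFDerivAt_right_eq_neg_left_of_integrable (μ := (volume : Measure E))
    (B := innerSL ℝ (E := E)) (f := w) (f' := fderiv ℝ w) (g := g) (g' := fderiv ℝ g) (v := b i)
    i1 i2 i3 (fun x _ => ((hwS.contDiff_nat 1).differentiable one_ne_zero x).hasFDerivAt)
    (fun x _ => ((hgS.contDiff_nat 1).differentiable one_ne_zero x).hasFDerivAt)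
  exact key

end DivergenceForm

/-! ## The trilinear paraproduct pieces -/

section Trilinear

variable {ι : Type*} [Fintype ι]

local notation "𝔼" => EuclideanSpace ℝ ι

/-- The trilinear paraproduct piece `𝒯_j(g; f, w) = ∫ ⟪g, Δ̇_j (⟪f, e⟫ w)⟫` (the pairing of a fixed `L²`
field `g` — a derivative of a block — with the block of a momentum-flux product). [folklore] -/
def trilin (j : ℤ) (g : 𝔼 → 𝔼) (e : 𝔼) (f w : 𝔼 → 𝔼) : ℝ :=
  ∫ x, ⟪g x, blockFn j (fun y => ⟪f y, e⟫ • w y) x⟫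

/-- The component `⟪Δ̇_l v, e⟫` is the block of the component `⟪v, e⟫`. [folklore] -/
theorem inner_blockFn_const_eq (l : ℤ) {v : 𝔼 → 𝔼} (hv : MemLp v 2 volume) (e : 𝔼) :
    (fun y => ⟪blockFn l v y, e⟫) = blockFn l (fun y => ⟪v y, e⟫) := by
  haveI : Fact (1 ≤ (2 : ℝ≥0∞)) := ⟨one_le_two⟩
  have h := blockFn_comp_clm l (innerSL ℝ e) hv
  have h1 : (fun y => ⟪blockFn l v y, e⟫) = fun y => (innerSL ℝ e) (blockFn l v y) := by
    funext y; rw [innerSL_apply_apply, real_inner_comm]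
  have h2 : (fun y => ⟪v y, e⟫) = fun y => (innerSL ℝ e) (v y) := by
    funext y; rw [innerSL_apply_apply, real_inner_comm]
  rw [h1, h2, h]

/-- **Vanishing of the far paraproduct pieces** (Fourier supports; `LittlewoodPaleyProducts`): if
`(l, l', j)` is a vanishing configuration then `𝒯_j(g; Δ̇_l v, Δ̇_{l'} v) = 0`. [folklore] -/
theorem trilin_blockFn_blockFn_eq_zero {l l' j : ℤ} (h : ParaproductVanishing l l' j) (g : 𝔼 → 𝔼) (e : 𝔼)
    {v : 𝔼 → 𝔼} (hv : MemLp v 2 volume) : trilin j g e (blockFn l v) (blockFn l' v) = 0 := by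
  unfold trilin
  have hφ : MemLp (fun y => ⟪v y, e⟫) 2 volume := by
    have : (fun y => ⟪v y, e⟫) = fun y => (innerSL ℝ e) (v y) := by
      funext y; rw [innerSL_apply_apply, real_inner_comm]
    rw [this]
    exact MemLp.of_le_mul (c := ‖innerSL ℝ e‖) hv ((innerSL ℝ e).continuous.comp_aestronglyMeasurable hv.1)
      (Eventually.of_forall fun x => (innerSL ℝ e).le_opNorm _)
  have hzero : blockFn j (fun y => ⟪blockFn l v y, e⟫ • blockFn l' v y) = 0 := by
    have h1 : (fun y => ⟪blockFn l v y, e⟫ • blockFn l' v y) = fun y => blockFn l (fun y => ⟪v y, e⟫) y • blockFn l' v y := by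
      funext y; rw [← inner_blockFn_const_eq l hv e]
    rw [h1]
    exact blockFn_smul_eq_zero_real h hφ hv
  simp [hzero]

/-- Pointwise bound on the flux integrand: `‖⟪f, e⟫ w‖ ≤ ‖f‖ ‖w‖` for `‖e‖ ≤ 1`. [folklore] -/
theorem norm_inner_smul_le {f w : 𝔼 → 𝔼} {e : 𝔼} (he : ‖e‖ ≤ 1) (y : 𝔼) :
    ‖⟪f y, e⟫ • w y‖ ≤ ‖f y‖ * ‖w y‖ := by
  rw [norm_smul]
  gcongr
  calc ‖⟪f y, e⟫‖ ≤ ‖f y‖ * ‖e‖ := norm_inner_le_norm _ _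
    _ ≤ ‖f y‖ * 1 := by gcongr
    _ = ‖f y‖ := mul_one _

/-- `L²` bound on the flux: `‖⟪f, e⟫ w‖₂ ≤ ‖f‖_∞ ‖w‖₂`. [folklore] -/
theorem eLpNorm_inner_smul_le_top_two {f w : 𝔼 → 𝔼} {e : 𝔼} (he : ‖e‖ ≤ 1)
    (hw : AEStronglyMeasurable w volume) :
    eLpNorm (fun y => ⟪f y, e⟫ • w y) 2 volume ≤ eLpNorm f ∞ volume * eLpNorm w 2 volume := by
  have h1 : ∀ y, ‖⟪f y, e⟫ • w y‖ ≤ ‖((fun y => ‖f y‖) • w) y‖ := fun y => by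
    change ‖⟪f y, e⟫ • w y‖ ≤ ‖‖f y‖ • w y‖
    rw [norm_smul (‖f y‖), norm_norm]
    exact norm_inner_smul_le he y
  calc eLpNorm (fun y => ⟪f y, e⟫ • w y) 2 volume ≤ eLpNorm ((fun y => ‖f y‖) • w) 2 volume := eLpNorm_mono h1
    _ ≤ eLpNorm (fun y => ‖f y‖) ∞ volume * eLpNorm w 2 volume :=
        eLpNorm_smul_le_eLpNorm_top_mul_eLpNorm 2 hw (fun y => ‖f y‖)
    _ = eLpNorm f ∞ volume * eLpNorm w 2 volume := by rw [eLpNorm_norm]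

/-- `L²` bound on the flux, the other way: `‖⟪f, e⟫ w‖₂ ≤ ‖f‖₂ ‖w‖_∞`. [folklore] -/
theorem eLpNorm_inner_smul_le_two_top {f w : 𝔼 → 𝔼} {e : 𝔼} (he : ‖e‖ ≤ 1) (hf : AEStronglyMeasurable f volume) :
    eLpNorm (fun y => ⟪f y, e⟫ • w y) 2 volume ≤ eLpNorm f 2 volume * eLpNorm w ∞ volume := by
  have h1 : ∀ y, ‖⟪f y, e⟫ • w y‖ ≤ ‖((fun y => ⟪f y, e⟫) • fun y => ‖w y‖) y‖ := fun y => by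
    change ‖⟪f y, e⟫ • w y‖ ≤ ‖⟪f y, e⟫ * ‖w y‖‖
    rw [norm_smul, norm_mul, norm_norm]
  have h2 : ∀ y, ‖⟪f y, e⟫‖ ≤ ‖f y‖ := fun y =>
    calc ‖⟪f y, e⟫‖ ≤ ‖f y‖ * ‖e‖ := norm_inner_le_norm _ _
      _ ≤ ‖f y‖ * 1 := by gcongr
      _ = ‖f y‖ := mul_one _
  calc eLpNorm (fun y => ⟪f y, e⟫ • w y) 2 volume
      ≤ eLpNorm ((fun y => ⟪f y, e⟫) • fun y => ‖w y‖) 2 volume := eLpNorm_mono h1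
    _ ≤ eLpNorm (fun y => ⟪f y, e⟫) 2 volume * eLpNorm (fun y => ‖w y‖) ∞ volume :=
        eLpNorm_smul_le_eLpNorm_mul_eLpNorm_top 2 _ (hf.inner aestronglyMeasurable_const)
    _ ≤ eLpNorm f 2 volume * eLpNorm w ∞ volume := by
        rw [eLpNorm_norm]
        gcongr
        exact eLpNorm_mono fun y => h2 y

/-- **Bound on a trilinear piece**: `‖𝒯_j(g; f, w)‖ ≤ ‖g‖₂ ‖Δ̇_j(⟪f,e⟫ w)‖₂` (Cauchy–Schwarz). [folklore] -/
theorem enorm_trilin_le (j : ℤ) {g f w : 𝔼 → 𝔼} (hg : AEStronglyMeasurable g volume) (e : 𝔼)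
    (hfw : AEStronglyMeasurable (fun y => ⟪f y, e⟫ • w y) volume) :
    ‖trilin j g e f w‖ₑ ≤ eLpNorm g 2 volume * eLpNorm (blockFn j (fun y => ⟪f y, e⟫ • w y)) 2 volume := by
  unfold trilin
  refine (enorm_integral_le_lintegral_enorm _).trans ?_
  refine (IsRegularSlab.lintegral_enorm_inner_le hg (aestronglyMeasurable_blockFn j hfw)).trans_eq ?_
  rw [eLpNorm_two_eq_lintegral' g, eLpNorm_two_eq_lintegral' (blockFn j _)]
  where
  /-- `‖f‖₂ = (∫ ‖f‖ₑ²)^{1/2}`. -/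
  eLpNorm_two_eq_lintegral' (φ : 𝔼 → 𝔼) :
      eLpNorm φ 2 (volume : Measure 𝔼) = (∫⁻ x, ‖φ x‖ₑ ^ 2) ^ (1 / 2 : ℝ) := by
    rw [eLpNorm_eq_lintegral_rpow_enorm_toReal two_ne_zero ENNReal.ofNat_ne_top, ENNReal.toReal_ofNat]
    simp_rw [ENNReal.rpow_two]

/-- The flux of an `L^∞` field against an `L²` field is in `L²`. [folklore] -/
theorem memLp_inner_smul_of_top {f w : 𝔼 → 𝔼} (e : 𝔼) (hf : MemLp f ∞ volume) (hw : MemLp w 2 volume) :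
    MemLp (fun y => ⟪f y, e⟫ • w y) 2 volume := by
  have hφ : MemLp (fun y => ⟪f y, e⟫) ∞ volume := by
    refine MemLp.of_le_mul (c := ‖e‖) hf (hf.1.inner aestronglyMeasurable_const) (Eventually.of_forall fun y => ?_)
    exact norm_inner_le_norm _ _ |>.trans (le_of_eq (mul_comm _ _))
  exact hw.smul (p := ∞) (q := 2) hφ

/-- The flux of an `L²` field against an `L^∞` field is in `L²`. [folklore] -/
theorem memLp_inner_smul_of_two {f w : 𝔼 → 𝔼} (e : 𝔼) (hf : MemLp f 2 volume) (hw : MemLp w ∞ volume) :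
    MemLp (fun y => ⟪f y, e⟫ • w y) 2 volume := by
  have hφ : MemLp (fun y => ⟪f y, e⟫) 2 volume := by
    refine MemLp.of_le_mul (c := ‖e‖) hf (hf.1.inner aestronglyMeasurable_const) (Eventually.of_forall fun y => ?_)
    exact norm_inner_le_norm _ _ |>.trans (le_of_eq (mul_comm _ _))
  exact hw.smul (p := 2) (q := ∞) hφ

/-- **Additivity of the trilinear piece in the first slot.** [folklore] -/
theorem trilin_add_left (j : ℤ) {g : 𝔼 → 𝔼} (hg : MemLp g 2 volume) (e : 𝔼) {f₁ f₂ w : 𝔼 → 𝔼}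
    (h₁ : MemLp (fun y => ⟪f₁ y, e⟫ • w y) 2 volume) (h₂ : MemLp (fun y => ⟪f₂ y, e⟫ • w y) 2 volume) :
    trilin j g e (f₁ + f₂) w = trilin j g e f₁ w + trilin j g e f₂ w := by
  haveI : Fact (1 ≤ (2 : ℝ≥0∞)) := ⟨one_le_two⟩
  unfold trilin
  have hsum : (fun y => ⟪(f₁ + f₂) y, e⟫ • w y) = (fun y => ⟪f₁ y, e⟫ • w y) + fun y => ⟪f₂ y, e⟫ • w y := by
    funext y; simp only [Pi.add_apply, inner_add_left, add_smul]
  rw [hsum, blockFn_add j h₁ h₂]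
  simp only [Pi.add_apply, inner_add_right]
  exact integral_add (integrable_inner_of_memLp_two hg (memLp_blockFn j h₁ one_le_two))
    (integrable_inner_of_memLp_two hg (memLp_blockFn j h₂ one_le_two))

/-- **Additivity of the trilinear piece in the second slot.** [folklore] -/
theorem trilin_add_right (j : ℤ) {g : 𝔼 → 𝔼} (hg : MemLp g 2 volume) (e : 𝔼) {f w₁ w₂ : 𝔼 → 𝔼}
    (h₁ : MemLp (fun y => ⟪f y, e⟫ • w₁ y) 2 volume) (h₂ : MemLp (fun y => ⟪f y, e⟫ • w₂ y) 2 volume) :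
    trilin j g e f (w₁ + w₂) = trilin j g e f w₁ + trilin j g e f w₂ := by
  haveI : Fact (1 ≤ (2 : ℝ≥0∞)) := ⟨one_le_two⟩
  unfold trilin
  have hsum : (fun y => ⟪f y, e⟫ • (w₁ + w₂) y) = (fun y => ⟪f y, e⟫ • w₁ y) + fun y => ⟪f y, e⟫ • w₂ y := by
    funext y; simp only [Pi.add_apply, smul_add]
  rw [hsum, blockFn_add j h₁ h₂]
  simp only [Pi.add_apply, inner_add_right]
  exact integral_add (integrable_inner_of_memLp_two hg (memLp_blockFn j h₁ one_le_two))
    (integrable_inner_of_memLp_two hg (memLp_blockFn j h₂ one_le_two))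

/-- The trilinear piece in the first slot over a finite sum of `L²` fields (second slot in `L^∞`). [folklore] -/
theorem trilin_sum_left (j : ℤ) {g : 𝔼 → 𝔼} (hg : MemLp g 2 volume) (e : 𝔼) {w : 𝔼 → 𝔼} (hw : MemLp w ∞ volume)
    (S : Finset ℤ) {f : ℤ → 𝔼 → 𝔼} (hf : ∀ l, MemLp (f l) 2 volume) :
    trilin j g e (∑ l ∈ S, f l) w = ∑ l ∈ S, trilin j g e (f l) w := by
  classical
  induction S using Finset.induction_on with
  | empty =>
    simp only [Finset.sum_empty]
    unfold trilin
    simp only [Pi.zero_apply, inner_zero_left, zero_smul]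
    rw [show (fun _ : 𝔼 => (0 : 𝔼)) = 0 from rfl, blockFn_zero]
    simp
  | insert a S ha ih =>
    rw [Finset.sum_insert ha, Finset.sum_insert ha, trilin_add_left j hg e (memLp_inner_smul_of_two e (hf a) hw) ?_, ih]
    exact memLp_inner_smul_of_two e (memLp_finsetSum' S fun l _ => hf l) hw

/-- The trilinear piece in the second slot over a finite sum of `L²` fields (first slot in `L^∞`). [folklore] -/
theorem trilin_sum_right (j : ℤ) {g : 𝔼 → 𝔼} (hg : MemLp g 2 volume) (e : 𝔼) {f : 𝔼 → 𝔼} (hf : MemLp f ∞ volume)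
    (S : Finset ℤ) {w : ℤ → 𝔼 → 𝔼} (hw : ∀ l, MemLp (w l) 2 volume) :
    trilin j g e f (∑ l ∈ S, w l) = ∑ l ∈ S, trilin j g e f (w l) := by
  classical
  induction S using Finset.induction_on with
  | empty =>
    simp only [Finset.sum_empty]
    unfold trilin
    simp only [Pi.zero_apply, smul_zero]
    rw [show (fun _ : 𝔼 => (0 : 𝔼)) = 0 from rfl, blockFn_zero]
    simp
  | insert a S ha ih =>
    rw [Finset.sum_insert ha, Finset.sum_insert ha, trilin_add_right j hg e (memLp_inner_smul_of_top e hf (hw a)) ?_, ih]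
    exact memLp_inner_smul_of_top e hf (memLp_finsetSum' S fun l _ => hw l)

/-- **Continuity bound in the first slot**: `‖𝒯_j(g; f, w)‖ ≤ ‖g‖₂ ‖K_j‖₁ ‖f‖₂ ‖w‖_∞`. [folklore] -/
theorem enorm_trilin_le_left (j : ℤ) {g f w : 𝔼 → 𝔼} (hg : AEStronglyMeasurable g volume) {e : 𝔼} (he : ‖e‖ ≤ 1)
    (hf : AEStronglyMeasurable f volume) (hw : AEStronglyMeasurable w volume) :
    ‖trilin j g e f w‖ₑ ≤ eLpNorm g 2 volume *
      ((∫⁻ y, ‖blockKernel 𝔼 j y‖ₑ) * (eLpNorm f 2 volume * eLpNorm w ∞ volume)) := by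
  have hfw : AEStronglyMeasurable (fun y => ⟪f y, e⟫ • w y) volume :=
    AEStronglyMeasurable.smul (𝕜 := ℝ) (f := fun y => ⟪f y, e⟫) (g := w) (hf.inner aestronglyMeasurable_const) hw
  refine (enorm_trilin_le j hg e hfw).trans ?_
  gcongr
  exact (eLpNorm_blockFn_le j hfw one_le_two).trans (mul_le_mul_right (eLpNorm_inner_smul_le_two_top he hf) _)

/-- **Continuity bound in the second slot**: `‖𝒯_j(g; f, w)‖ ≤ ‖g‖₂ ‖K_j‖₁ ‖f‖_∞ ‖w‖₂`. [folklore] -/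
theorem enorm_trilin_le_right (j : ℤ) {g f w : 𝔼 → 𝔼} (hg : AEStronglyMeasurable g volume) {e : 𝔼} (he : ‖e‖ ≤ 1)
    (hf : AEStronglyMeasurable f volume) (hw : AEStronglyMeasurable w volume) :
    ‖trilin j g e f w‖ₑ ≤ eLpNorm g 2 volume *
      ((∫⁻ y, ‖blockKernel 𝔼 j y‖ₑ) * (eLpNorm f ∞ volume * eLpNorm w 2 volume)) := by
  have hfw : AEStronglyMeasurable (fun y => ⟪f y, e⟫ • w y) volume :=
    AEStronglyMeasurable.smul (𝕜 := ℝ) (f := fun y => ⟪f y, e⟫) (g := w) (hf.inner aestronglyMeasurable_const) hw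
  refine (enorm_trilin_le j hg e hfw).trans ?_
  gcongr
  exact (eLpNorm_blockFn_le j hfw one_le_two).trans (mul_le_mul_right (eLpNorm_inner_smul_le_top_two he hw) _)

/-- If `x = lim_N ∑_{|l| ≤ N} y_l` then `‖x‖ ≤ ∑_l ‖y_l‖` (in `ℝ≥0∞`). [folklore] -/
theorem enorm_le_tsum_of_tendsto_sum {x : ℝ} {y : ℤ → ℝ}
    (h : Tendsto (fun N : ℕ => ∑ l ∈ Finset.Icc (-(N : ℤ)) N, y l) atTop (𝓝 x)) :
    ‖x‖ₑ ≤ ∑' l, ‖y l‖ₑ := by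
  have h1 : Tendsto (fun N : ℕ => ‖∑ l ∈ Finset.Icc (-(N : ℤ)) N, y l‖ₑ) atTop (𝓝 ‖x‖ₑ) :=
    (continuous_enorm.tendsto x).comp h
  refine le_of_tendsto' h1 fun N => ?_
  exact (enorm_sum_le _ _).trans (ENNReal.sum_le_tsum _)

/-- An `ℝ≥0∞`-bound turns `L²`-convergence into convergence of real quantities. [folklore] -/
theorem tendsto_of_enorm_sub_le_mul {a : ℕ → ℝ} {b : ℝ} {C : ℝ≥0∞} (hC : C ≠ ∞) {ε : ℕ → ℝ≥0∞}
    (hε : Tendsto ε atTop (𝓝 0)) (h : ∀ N, ‖a N - b‖ₑ ≤ C * ε N) : Tendsto a atTop (𝓝 b) := by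
  have h0 : Tendsto (fun N => C * ε N) atTop (𝓝 0) := by
    have := ENNReal.Tendsto.const_mul hε (Or.inr hC)
    simpa using this
  have h1 : Tendsto (fun N => ‖a N - b‖ₑ) atTop (𝓝 0) :=
    tendsto_of_tendsto_of_tendsto_of_le_of_le tendsto_const_nhds h0 (fun N => bot_le) h
  have h2 : Tendsto (fun N => ‖a N - b‖) atTop (𝓝 0) := by
    have := (ENNReal.tendsto_toReal ENNReal.zero_ne_top).comp h1
    refine (tendsto_congr fun N => ?_).1 this
    simp only [Function.comp_apply, ← ofReal_norm, ENNReal.toReal_ofReal (norm_nonneg _)]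
  exact tendsto_iff_norm_sub_tendsto_zero.2 h2

/-- **The first slot is recovered from the blocks**: if `∑_{|l|≤N} Δ̇_l v → v` in `L²` then
`∑_{|l|≤N} 𝒯_j(g; Δ̇_l v, w) → 𝒯_j(g; v, w)` for `w ∈ L^∞`. [folklore] -/
theorem tendsto_sum_trilin_blockFn_left (j : ℤ) {g : 𝔼 → 𝔼} (hg : MemLp g 2 volume) {e : 𝔼} (he : ‖e‖ ≤ 1)
    {v w : 𝔼 → 𝔼} (hv : MemLp v 2 volume) (hw : MemLp w ∞ volume)
    (hconv : Tendsto (fun N : ℕ => eLpNorm (v - ∑ l ∈ Finset.Icc (-(N : ℤ)) N, blockFn l v) 2 volume) atTop (𝓝 0)) :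
    Tendsto (fun N : ℕ => ∑ l ∈ Finset.Icc (-(N : ℤ)) N, trilin j g e (blockFn l v) w) atTop
      (𝓝 (trilin j g e v w)) := by
  set fN : ℕ → 𝔼 → 𝔼 := fun N => ∑ l ∈ Finset.Icc (-(N : ℤ)) N, blockFn l v with hfN
  have hfN2 : ∀ N, MemLp (fN N) 2 volume := fun N => memLp_finsetSum' _ fun l _ => memLp_blockFn l hv one_le_two
  have hsum : ∀ N : ℕ, ∑ l ∈ Finset.Icc (-(N : ℤ)) N, trilin j g e (blockFn l v) w = trilin j g e (fN N) w :=
    fun N => (trilin_sum_left j hg e hw _ fun l => memLp_blockFn l hv one_le_two).symm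
  simp_rw [hsum]
  -- `𝒯(v, w) = 𝒯(v - f_N, w) + 𝒯(f_N, w)`
  have hsplit : ∀ N, trilin j g e (fN N) w - trilin j g e v w = -trilin j g e (v - fN N) w := by
    intro N
    have h := trilin_add_left j hg e (f₁ := v - fN N) (f₂ := fN N) (w := w)
      (memLp_inner_smul_of_two e (hv.sub (hfN2 N)) hw) (memLp_inner_smul_of_two e (hfN2 N) hw)
    rw [sub_add_cancel] at h
    rw [h]; ring
  refine tendsto_of_enorm_sub_le_mul (C := eLpNorm g 2 volume * ((∫⁻ y, ‖blockKernel 𝔼 j y‖ₑ) * eLpNorm w ∞ volume))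
    (ENNReal.mul_ne_top hg.eLpNorm_ne_top (ENNReal.mul_ne_top (integrable_blockKernel j).2.ne hw.eLpNorm_ne_top))
    hconv fun N => ?_
  rw [hsplit, enorm_neg]
  refine (enorm_trilin_le_left j hg.1 he (hv.sub (hfN2 N)).1 hw.1).trans_eq ?_
  ring

/-- **The second slot is recovered from the blocks**: if `∑_{|l|≤N} Δ̇_l v → v` in `L²` then
`∑_{|l'|≤N} 𝒯_j(g; f, Δ̇_{l'} v) → 𝒯_j(g; f, v)` for `f ∈ L^∞`. [folklore] -/
theorem tendsto_sum_trilin_blockFn_right (j : ℤ) {g : 𝔼 → 𝔼} (hg : MemLp g 2 volume) {e : 𝔼} (he : ‖e‖ ≤ 1)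
    {f v : 𝔼 → 𝔼} (hf : MemLp f ∞ volume) (hv : MemLp v 2 volume)
    (hconv : Tendsto (fun N : ℕ => eLpNorm (v - ∑ l ∈ Finset.Icc (-(N : ℤ)) N, blockFn l v) 2 volume) atTop (𝓝 0)) :
    Tendsto (fun N : ℕ => ∑ l ∈ Finset.Icc (-(N : ℤ)) N, trilin j g e f (blockFn l v)) atTop
      (𝓝 (trilin j g e f v)) := by
  set fN : ℕ → 𝔼 → 𝔼 := fun N => ∑ l ∈ Finset.Icc (-(N : ℤ)) N, blockFn l v with hfN
  have hfN2 : ∀ N, MemLp (fN N) 2 volume := fun N => memLp_finsetSum' _ fun l _ => memLp_blockFn l hv one_le_two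
  have hsum : ∀ N : ℕ, ∑ l ∈ Finset.Icc (-(N : ℤ)) N, trilin j g e f (blockFn l v) = trilin j g e f (fN N) :=
    fun N => (trilin_sum_right j hg e hf _ fun l => memLp_blockFn l hv one_le_two).symm
  simp_rw [hsum]
  have hsplit : ∀ N, trilin j g e f (fN N) - trilin j g e f v = -trilin j g e f (v - fN N) := by
    intro N
    have h := trilin_add_right j hg e (f := f) (w₁ := v - fN N) (w₂ := fN N)
      (memLp_inner_smul_of_top e hf (hv.sub (hfN2 N))) (memLp_inner_smul_of_top e hf (hfN2 N))
    rw [sub_add_cancel] at h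
    rw [h]; ring
  refine tendsto_of_enorm_sub_le_mul (C := eLpNorm g 2 volume * ((∫⁻ y, ‖blockKernel 𝔼 j y‖ₑ) * eLpNorm f ∞ volume))
    (ENNReal.mul_ne_top hg.eLpNorm_ne_top (ENNReal.mul_ne_top (integrable_blockKernel j).2.ne hf.eLpNorm_ne_top))
    hconv fun N => ?_
  rw [hsplit, enorm_neg]
  refine (enorm_trilin_le_right j hg.1 he hf.1 (hv.sub (hfN2 N)).1).trans_eq ?_
  ring

/-- **The trilinear term is dominated by the double block sum**: if the partial block sums of `v`
converge to `v` in `L²` (`v ∈ L² ∩ L^∞`), then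
`‖𝒯_j(g; v, v)‖ ≤ ∑_l ∑_{l'} ‖𝒯_j(g; Δ̇_l v, Δ̇_{l'} v)‖`. [folklore] -/
theorem enorm_trilin_le_tsum_tsum (j : ℤ) {g : 𝔼 → 𝔼} (hg : MemLp g 2 volume) {e : 𝔼} (he : ‖e‖ ≤ 1)
    {v : 𝔼 → 𝔼} (hv : MemLp v 2 volume) (hv' : MemLp v ∞ volume)
    (hconv : Tendsto (fun N : ℕ => eLpNorm (v - ∑ l ∈ Finset.Icc (-(N : ℤ)) N, blockFn l v) 2 volume) atTop (𝓝 0)) :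
    ‖trilin j g e v v‖ₑ ≤ ∑' l, ∑' l', ‖trilin j g e (blockFn l v) (blockFn l' v)‖ₑ := by
  haveI : Fact (1 ≤ (2 : ℝ≥0∞)) := ⟨one_le_two⟩
  refine (enorm_le_tsum_of_tendsto_sum (tendsto_sum_trilin_blockFn_left j hg he hv hv' hconv)).trans ?_
  refine ENNReal.tsum_le_tsum fun l => ?_
  exact enorm_le_tsum_of_tendsto_sum
    (tendsto_sum_trilin_blockFn_right j hg he (memLp_top_blockFn l hv) hv hconv)

/-! ### Reindexing the double block sum onto the paraproduct shapes -/

omit [Fintype ι] in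
/-- `∑_l [k ≤ l] F_l = ∑_n F_{k+n}`. [folklore] -/
theorem tsum_ite_ge_eq (F : ℤ → ℝ≥0∞) (k : ℤ) :
    ∑' l : ℤ, (if k ≤ l then F l else 0) = ∑' n : ℕ, F (k + n) := by
  have hsupp : ∀ l : ℤ, l ∉ Set.range (fun n : ℕ => k + (n : ℤ)) → (if k ≤ l then F l else 0) = 0 := by
    intro l hl
    by_cases h : k ≤ l
    · exfalso; apply hl
      refine ⟨(l - k).toNat, ?_⟩
      simp only
      rw [Int.toNat_of_nonneg (by omega)]
      ring
    · rw [if_neg h]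
  rw [← tsum_subtype_eq_of_support_subset (s := Set.range (fun n : ℕ => k + (n : ℤ))) ?_]
  · rw [← Equiv.tsum_eq (Equiv.ofInjective (fun n : ℕ => k + (n : ℤ)) (fun a b hab => by simpa using hab))]
    refine tsum_congr fun n => ?_
    simp only [Equiv.ofInjective_apply]
    rw [if_pos (by omega)]
  · intro l hl
    by_contra hc
    exact hl (hsupp l hc)

omit [Fintype ι] in
/-- `∑_{l'} [|l' - c| ≤ 2] F_{l'} = ∑_{m=-2}^{2} F_{c+m}`. [folklore] -/
theorem tsum_ite_abs_sub_le_two_eq (F : ℤ → ℝ≥0∞) (c : ℤ) :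
    ∑' l : ℤ, (if |l - c| ≤ 2 then F l else 0) = ∑ m ∈ Finset.Icc (-2 : ℤ) 2, F (c + m) := by
  rw [tsum_eq_sum (s := Finset.Icc (c - 2) (c + 2)) fun l hl => ?_]
  · rw [show Finset.Icc (c - 2) (c + 2) = (Finset.Icc (-2 : ℤ) 2).image (c + ·) by
      rw [Finset.image_add_left_Icc]; congr 1]
    rw [Finset.sum_image fun a _ b _ hab => by simpa using hab]
    refine Finset.sum_congr rfl fun m hm => ?_
    rw [Finset.mem_Icc] at hm
    rw [if_pos (by rw [abs_le]; constructor <;> omega)]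
  · rw [Finset.mem_Icc] at hl
    rw [if_neg (by rw [abs_le]; omega)]

omit [Fintype ι] in
/-- **The low–high shape**: `∑_l ∑_{l'} [l ≤ l'-3, |l'-j| ≤ 2] s_l a_{l'} = ∑_{|m|≤2} a_{j+m} T_{j+m}`. [folklore] -/
theorem tsum_tsum_lowHigh_eq (s a : ℤ → ℝ≥0∞) (j : ℤ) :
    ∑' l : ℤ, ∑' l' : ℤ, (if l ≤ l' - 3 ∧ |l' - j| ≤ 2 then s l * a l' else 0) =
      ∑ m ∈ Finset.Icc (-2 : ℤ) 2, a (j + m) * paraT s (j + m) := by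
  rw [ENNReal.tsum_comm]
  have h1 : ∀ l', ∑' l : ℤ, (if l ≤ l' - 3 ∧ |l' - j| ≤ 2 then s l * a l' else 0) =
      if |l' - j| ≤ 2 then a l' * paraT s l' else 0 := by
    intro l'
    by_cases h : |l' - j| ≤ 2
    · have hT : paraT s l' = ∑' l : ℤ, (if l < l' - 2 then s l else 0) := by
        rw [paraT, tsum_ite_lt_eq s (l' - 2)]
        exact tsum_congr fun n => by congr 1; ring
      rw [if_pos h, hT, ← ENNReal.tsum_mul_left]
      refine tsum_congr fun l => ?_
      by_cases hl : l ≤ l' - 3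
      · rw [if_pos ⟨hl, h⟩, if_pos (by omega), mul_comm]
      · rw [if_neg (fun h' => hl h'.1), if_neg (by omega), mul_zero]
    · rw [if_neg h]
      exact ENNReal.tsum_eq_zero.2 fun l => if_neg fun h' => h h'.2
  simp_rw [h1]
  exact tsum_ite_abs_sub_le_two_eq (fun l' => a l' * paraT s l') j

omit [Fintype ι] in
/-- **The high–low shape**: `∑_l ∑_{l'} [l' ≤ l-3, |l-j| ≤ 2] a_l s_{l'} = ∑_{|m|≤2} a_{j+m} T_{j+m}`. [folklore] -/
theorem tsum_tsum_highLow_eq (s a : ℤ → ℝ≥0∞) (j : ℤ) :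
    ∑' l : ℤ, ∑' l' : ℤ, (if l' ≤ l - 3 ∧ |l - j| ≤ 2 then a l * s l' else 0) =
      ∑ m ∈ Finset.Icc (-2 : ℤ) 2, a (j + m) * paraT s (j + m) := by
  have h1 : ∀ l, ∑' l' : ℤ, (if l' ≤ l - 3 ∧ |l - j| ≤ 2 then a l * s l' else 0) =
      if |l - j| ≤ 2 then a l * paraT s l else 0 := by
    intro l
    by_cases h : |l - j| ≤ 2
    · have hT : paraT s l = ∑' l' : ℤ, (if l' < l - 2 then s l' else 0) := by
        rw [paraT, tsum_ite_lt_eq s (l - 2)]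
        exact tsum_congr fun n => by congr 1; ring
      rw [if_pos h, hT, ← ENNReal.tsum_mul_left]
      refine tsum_congr fun l' => ?_
      by_cases hl : l' ≤ l - 3
      · rw [if_pos ⟨hl, h⟩, if_pos (by omega)]
      · rw [if_neg (fun h' => hl h'.1), if_neg (by omega), mul_zero]
    · rw [if_neg h]
      exact ENNReal.tsum_eq_zero.2 fun l' => if_neg fun h' => h h'.2
  simp_rw [h1]
  exact tsum_ite_abs_sub_le_two_eq (fun l => a l * paraT s l) j

omit [Fintype ι] in
/-- **The diagonal shape**: `∑_l ∑_{l'} [|l-l'| ≤ 2, j-4 ≤ l] s_l a_{l'} = Q₂(j)`. [folklore] -/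
theorem tsum_tsum_diag_eq (s a : ℤ → ℝ≥0∞) (j : ℤ) :
    ∑' l : ℤ, ∑' l' : ℤ, (if |l' - l| ≤ 2 ∧ j - 4 ≤ l then s l * a l' else 0) = paraQ2 s a j := by
  have h1 : ∀ l, ∑' l' : ℤ, (if |l' - l| ≤ 2 ∧ j - 4 ≤ l then s l * a l' else 0) =
      if j - 4 ≤ l then ∑ m ∈ Finset.Icc (-2 : ℤ) 2, s l * a (l + m) else 0 := by
    intro l
    by_cases h : j - 4 ≤ l
    · rw [if_pos h, ← tsum_ite_abs_sub_le_two_eq (fun l' => s l * a l') l]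
      refine tsum_congr fun l' => ?_
      by_cases hl : |l' - l| ≤ 2
      · rw [if_pos ⟨hl, h⟩, if_pos hl]
      · rw [if_neg (fun h' => hl h'.1), if_neg hl]
    · rw [if_neg h]
      exact ENNReal.tsum_eq_zero.2 fun l' => if_neg fun h' => h h'.2
  simp_rw [h1]
  rw [tsum_ite_ge_eq, paraQ2]

/-! ### The block-pair bound and its summation -/

/-- **Bound on one block pair.** With a uniform `L² → L²` bound `C₂` for `Δ̇_j`, `a_l = ‖Δ̇_l v‖₂`,
`s_l = ‖Δ̇_l v‖_∞`: the piece `𝒯_j(g; Δ̇_l v, Δ̇_{l'} v)` vanishes unless `(l, l')` is a low–high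
(`l ≤ l'-3`, `|l'-j| ≤ 2`), high–low, or diagonal (`|l-l'| ≤ 2`, `l ≥ j-4`) pair, and is bounded by
`‖g‖₂ C₂ s_l a_{l'}`, `‖g‖₂ C₂ a_l s_{l'}`, `‖g‖₂ C₂ s_l a_{l'}` respectively. [folklore] -/
theorem enorm_trilin_blockFn_blockFn_le (j : ℤ) {g : 𝔼 → 𝔼} (hg : MemLp g 2 volume) {e : 𝔼} (he : ‖e‖ ≤ 1)
    {v : 𝔼 → 𝔼} (hv : MemLp v 2 volume) {C₂ : ℝ≥0∞}
    (hC₂ : ∀ f : 𝔼 → 𝔼, MemLp f 2 volume → eLpNorm (blockFn j f) 2 volume ≤ C₂ * eLpNorm f 2 volume) (l l' : ℤ) :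
    ‖trilin j g e (blockFn l v) (blockFn l' v)‖ₑ ≤ eLpNorm g 2 volume * C₂ *
      ((if l ≤ l' - 3 ∧ |l' - j| ≤ 2 then eLpNorm (blockFn l v) ∞ volume * eLpNorm (blockFn l' v) 2 volume else 0) +
       (if l' ≤ l - 3 ∧ |l - j| ≤ 2 then eLpNorm (blockFn l v) 2 volume * eLpNorm (blockFn l' v) ∞ volume else 0) +
       (if |l' - l| ≤ 2 ∧ j - 4 ≤ l then eLpNorm (blockFn l v) ∞ volume * eLpNorm (blockFn l' v) 2 volume else 0)) := by
  haveI : Fact (1 ≤ (2 : ℝ≥0∞)) := ⟨one_le_two⟩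
  by_cases hV : ParaproductVanishing l l' j
  · rw [trilin_blockFn_blockFn_eq_zero hV g e hv, enorm_zero]; exact bot_le
  -- the two generic bounds
  have h2l : MemLp (blockFn l v) 2 volume := memLp_blockFn l hv one_le_two
  have h2l' : MemLp (blockFn l' v) 2 volume := memLp_blockFn l' hv one_le_two
  have htl : MemLp (blockFn l v) ∞ volume := memLp_top_blockFn l hv
  have htl' : MemLp (blockFn l' v) ∞ volume := memLp_top_blockFn l' hv
  have hflux : MemLp (fun y => ⟪blockFn l v y, e⟫ • blockFn l' v y) 2 volume := memLp_inner_smul_of_top e htl h2l'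
  have hA : ‖trilin j g e (blockFn l v) (blockFn l' v)‖ₑ ≤
      eLpNorm g 2 volume * C₂ * (eLpNorm (blockFn l v) ∞ volume * eLpNorm (blockFn l' v) 2 volume) := by
    refine (enorm_trilin_le j hg.1 e hflux.1).trans ?_
    rw [mul_assoc]
    gcongr
    exact (hC₂ _ hflux).trans (mul_le_mul_right (eLpNorm_inner_smul_le_top_two he h2l'.1) _)
  have hB : ‖trilin j g e (blockFn l v) (blockFn l' v)‖ₑ ≤
      eLpNorm g 2 volume * C₂ * (eLpNorm (blockFn l v) 2 volume * eLpNorm (blockFn l' v) ∞ volume) := by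
    refine (enorm_trilin_le j hg.1 e hflux.1).trans ?_
    rw [mul_assoc]
    gcongr
    exact (hC₂ _ hflux).trans (mul_le_mul_right (eLpNorm_inner_smul_le_two_top he h2l.1) _)
  -- the surviving configurations
  have hcases : (l ≤ l' - 3 ∧ |l' - j| ≤ 2) ∨ (l' ≤ l - 3 ∧ |l - j| ≤ 2) ∨ (|l' - l| ≤ 2 ∧ j - 4 ≤ l) := by
    unfold ParaproductVanishing at hV
    rw [abs_le, abs_le, abs_le]
    omega
  rcases hcases with hLH | hHL | hD
  · refine hA.trans ?_
    gcongr
    rw [if_pos hLH]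
    exact le_add_of_le_of_nonneg (le_add_of_le_of_nonneg le_rfl bot_le) bot_le
  · refine hB.trans ?_
    gcongr
    rw [if_pos hHL]
    exact le_add_of_le_of_nonneg (le_add_of_nonneg_of_le bot_le le_rfl) bot_le
  · refine hA.trans ?_
    gcongr
    rw [if_pos hD]
    exact le_add_of_nonneg_of_le bot_le le_rfl

/-- **The double block sum is bounded by the paraproduct shapes**:
`∑_l ∑_{l'} ‖𝒯_j(g; Δ̇_l v, Δ̇_{l'} v)‖ ≤ ‖g‖₂ C₂ (2 ∑_{|m|≤2} a_{j+m} T_{j+m} + Q₂(j))` with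
`a_l = ‖Δ̇_l v‖₂`, `s_l = ‖Δ̇_l v‖_∞`, `T = paraT s`, `Q₂ = paraQ2 s a` (Cheskidov–Shvydkoy's split of the
flux into `I + II + III`, arXiv:0708.3067 p. 5). [folklore] -/
theorem tsum_tsum_enorm_trilin_le (j : ℤ) {g : 𝔼 → 𝔼} (hg : MemLp g 2 volume) {e : 𝔼} (he : ‖e‖ ≤ 1)
    {v : 𝔼 → 𝔼} (hv : MemLp v 2 volume) {C₂ : ℝ≥0∞}
    (hC₂ : ∀ f : 𝔼 → 𝔼, MemLp f 2 volume → eLpNorm (blockFn j f) 2 volume ≤ C₂ * eLpNorm f 2 volume) :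
    ∑' l, ∑' l', ‖trilin j g e (blockFn l v) (blockFn l' v)‖ₑ ≤ eLpNorm g 2 volume * C₂ *
      (2 * ∑ m ∈ Finset.Icc (-2 : ℤ) 2, eLpNorm (blockFn (j + m) v) 2 volume *
          paraT (fun l => eLpNorm (blockFn l v) ∞ volume) (j + m) +
        paraQ2 (fun l => eLpNorm (blockFn l v) ∞ volume) (fun l => eLpNorm (blockFn l v) 2 volume) j) := by
  set a : ℤ → ℝ≥0∞ := fun l => eLpNorm (blockFn l v) 2 volume with ha
  set s : ℤ → ℝ≥0∞ := fun l => eLpNorm (blockFn l v) ∞ volume with hs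
  set G := eLpNorm g 2 volume * C₂ with hG
  calc ∑' l, ∑' l', ‖trilin j g e (blockFn l v) (blockFn l' v)‖ₑ
      ≤ ∑' l, ∑' l', G * ((if l ≤ l' - 3 ∧ |l' - j| ≤ 2 then s l * a l' else 0) +
          (if l' ≤ l - 3 ∧ |l - j| ≤ 2 then a l * s l' else 0) +
          (if |l' - l| ≤ 2 ∧ j - 4 ≤ l then s l * a l' else 0)) :=
        ENNReal.tsum_le_tsum fun l => ENNReal.tsum_le_tsum fun l' => enorm_trilin_blockFn_blockFn_le j hg he hv hC₂ l l'
    _ = G * ((∑' l, ∑' l', (if l ≤ l' - 3 ∧ |l' - j| ≤ 2 then s l * a l' else 0)) +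
          (∑' l, ∑' l', (if l' ≤ l - 3 ∧ |l - j| ≤ 2 then a l * s l' else 0)) +
          ∑' l, ∑' l', (if |l' - l| ≤ 2 ∧ j - 4 ≤ l then s l * a l' else 0)) := by
        rw [← ENNReal.tsum_add, ← ENNReal.tsum_add, ← ENNReal.tsum_mul_left]
        refine tsum_congr fun l => ?_
        rw [← ENNReal.tsum_add, ← ENNReal.tsum_add, ← ENNReal.tsum_mul_left]
    _ = G * (2 * ∑ m ∈ Finset.Icc (-2 : ℤ) 2, a (j + m) * paraT s (j + m) + paraQ2 s a j) := by
        rw [tsum_tsum_lowHigh_eq, tsum_tsum_highLow_eq, tsum_tsum_diag_eq, two_mul]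

/-- **The nonlinear term of the `j`-th block energy balance is bounded by the paraproduct shapes**
(Cheskidov–Shvydkoy 2010, proof of Lemma 3.2: `∫ Tr[(u⊗u)_q · ∇u_q] ≤ I + II + III`, p. 5). For a
divergence-free smooth `L²` field `v` on `ℝ^ι` whose partial block sums converge to `v` in `L²`, with
`v_j = Δ̇_j v`, `a_l = ‖v_l‖₂`, `s_l = ‖v_l‖_∞` and a uniform `L² → L²` bound `C₂` for `Δ̇_j`:
`‖∫ ⟪v_j, Δ̇_j ((v·∇)v)⟫‖ ≤ (∑_i ‖∂_i v_j‖₂) C₂ (2 ∑_{|m|≤2} a_{j+m} T_{j+m} + Q₂(j))`.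
[cite: CheskidovShvydkoy2010, Lemma 3.2 (proof, p. 5)] -/
theorem enorm_integral_inner_blockFn_convect_le {v : 𝔼 → 𝔼} (hv : IsSmoothL2Field v)
    (hdiv : VectorCalculus.IsDivFree v)
    (hconv : Tendsto (fun N : ℕ => eLpNorm (v - ∑ l ∈ Finset.Icc (-(N : ℤ)) N, blockFn l v) 2 volume) atTop (𝓝 0))
    (j : ℤ) {C₂ : ℝ≥0∞}
    (hC₂ : ∀ f : 𝔼 → 𝔼, MemLp f 2 volume → eLpNorm (blockFn j f) 2 volume ≤ C₂ * eLpNorm f 2 volume) :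
    ‖∫ x, ⟪blockFn j v x, blockFn j (convect v v) x⟫‖ₑ ≤
      (∑ i, eLpNorm (fun x => fderiv ℝ (blockFn j v) x (stdOrthonormalBasis ℝ 𝔼 i)) 2 volume) * C₂ *
        (2 * ∑ m ∈ Finset.Icc (-2 : ℤ) 2, eLpNorm (blockFn (j + m) v) 2 volume *
            paraT (fun l => eLpNorm (blockFn l v) ∞ volume) (j + m) +
          paraQ2 (fun l => eLpNorm (blockFn l v) ∞ volume) (fun l => eLpNorm (blockFn l v) 2 volume) j) := by
  set b := stdOrthonormalBasis ℝ 𝔼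
  rw [integral_inner_blockFn_convect_eq hv hdiv j, enorm_neg]
  refine (enorm_sum_le _ _).trans ?_
  rw [Finset.sum_mul, Finset.sum_mul]
  refine Finset.sum_le_sum fun i _ => ?_
  have hgi : MemLp (fun x => fderiv ℝ (blockFn j v) x (b i)) 2 volume := (hv.blockFn j).memLp_fderiv_apply (b i)
  have hvt : MemLp v ∞ volume := memLp_top_of_hasBoundedDerivs hv.toHasBoundedDerivs
  have h1 := enorm_trilin_le_tsum_tsum j hgi (e := b i) (le_of_eq (b.orthonormal.1 i)) hv.memLp_two hvt hconv
  exact h1.trans (tsum_tsum_enorm_trilin_le j hgi (le_of_eq (b.orthonormal.1 i)) hv.memLp_two hC₂)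

end Trilinear

end Literature.Analysis.FluidPDE

end
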